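import Summits.Ventures.Crystal3D.Theorems.StickyWulffConstantNoReconstructionGainExactThinNoCriminalB
import Summits.Ventures.Crystal3D.Theorems.StickyWulffConstantNoReconstructionGainExactCriminalBuried
import Summits.Ventures.Crystal3D.Theorems.StickyWulffConstantNoReconstructionGainExactFilmAboveCutAll
import HarnessLib

/-!
# Profile of the heavy ball of a criminal (line `replication-exactness`, summary theorem)

HONEST FRAMING. Part of the venture `Summits/Ventures/Crystal3D` (cell `crystal3d-full`), supports the
crux `NoReconstructionGain` (stmt-Ventures-19144, route `route-Ventures-StickyWulffConstant`), line
`replication-exactness` (lead wulff-p1 g18).  One-stop statement, for planners and disprovers, of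
what the landed anatomy says about ONE ball of any criminal (minimal counterexample to EXACT₀):
`exists_offLattice_ten_contacts_of_criminal` (`…ExactCriminalHeavy`), `exists_partner_neg_side_of_ten`
(`…ExactCriminalBuried`), `IsFilmOn.lt_inner` (`…ExactFilmAboveCutAll`) and the thin-star exclusion
`seven_thin_unit_vectors_false'` (`…ExactThinNoCriminalB`) combined.

* `exists_heavyBall_profile` — every criminal on `H(ν,s)` contains a ball `q` with: `q ∉ Λ₀`;
  `q` strictly above the cut; at least `10` partners (plugs + film balls), at least `7` of them
  off-lattice film balls and at least one a lattice point; partners strictly on both sides of every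
  plane through `q` (buried); and for EVERY unit vector `e` two points of `{q} ∪ {off-lattice
  partners of q}` whose `e`-heights differ by more than `7/20` (the star of `q` is thick in every
  direction).

WHAT THIS IS NOT: new mathematics (it is a conjunction of landed facts); the crux; rung F-C1.
-/

noncomputable section

namespace Summit.Ventures.Crystal3D.Theorems

open Summit.Ventures.Crystal3D
open Literature.MathematicalPhysics.StatisticalMechanics (fccStacking)
open scoped InnerProductSpace
open Finset

open scoped Classical in
/-- **Profile of the heavy ball of a criminal.** -/
theorem exists_heavyBall_profile {ν : EuclideanSpace ℝ (Fin 3)} (hν : ‖ν‖ = 1) {s : ℝ}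
    {Q : Finset (EuclideanSpace ℝ (Fin 3))} (hQ : IsCriminal ν s Q) :
    ∃ q ∈ Q, q ∉ fccStacking 1 (Real.sqrt (2 / 3)) ∧ s < ⟪q, ν⟫_ℝ ∧
      10 ≤ (plugSet ν s q).ncard + (Q.filter fun y => dist q y = 1).card ∧
      7 ≤ (Q.filter fun y => y ∉ fccStacking 1 (Real.sqrt (2 / 3)) ∧ dist q y = 1).card ∧
      1 ≤ (plugSet ν s q).ncard +
        (Q.filter fun y => y ∈ fccStacking 1 (Real.sqrt (2 / 3)) ∧ dist q y = 1).card ∧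
      (∀ e : EuclideanSpace ℝ (Fin 3), ‖e‖ = 1 →
        ∃ x, (x ∈ plugSet ν s q ∨ (x ∈ Q ∧ dist q x = 1)) ∧ ⟪e, x - q⟫_ℝ < 0) ∧
      (∀ e : EuclideanSpace ℝ (Fin 3), ‖e‖ = 1 →
        ∃ x ∈ insert q (Q.filter fun y => y ∉ fccStacking 1 (Real.sqrt (2 / 3)) ∧ dist q y = 1),
        ∃ y ∈ insert q (Q.filter fun y => y ∉ fccStacking 1 (Real.sqrt (2 / 3)) ∧ dist q y = 1),
          7 / 20 < ⟪x - y, e⟫_ℝ) := by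
  obtain ⟨q, hq, hqΛ, h10, h1, h7⟩ := exists_offLattice_ten_contacts_of_criminal hQ
  refine ⟨q, hq, hqΛ, IsFilmOn.lt_inner hν hQ.1 hq, h10, h7, h1,
    fun e he => exists_partner_neg_side_of_ten hQ.1 h10 he, fun e he => ?_⟩
  -- thickness of the star: otherwise seven near-horizontal unit bond vectors
  by_contra hthin
  push Not at hthin
  set N := Q.filter fun y => y ∉ fccStacking 1 (Real.sqrt (2 / 3)) ∧ dist q y = 1 with hN
  have hle : ∀ x ∈ insert q N, ∀ y ∈ insert q N, |⟪x - y, e⟫_ℝ| ≤ 7 / 20 := by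
    intro x hx y hy
    rw [abs_le]
    refine ⟨?_, hthin x hx y hy⟩
    have h := hthin y hy x hx
    rw [← neg_sub, inner_neg_left] at h
    linarith
  obtain ⟨T, hT, hTc⟩ := Finset.exists_subset_card_eq h7
  set g := (T.equivFinOfCardEq hTc).symm with hg
  have hmem : ∀ i, ((g i : EuclideanSpace ℝ (Fin 3)) ∈ Q ∧ (g i : EuclideanSpace ℝ (Fin 3)) ∈ N ∧
      dist q (g i) = 1) := by
    intro i
    have h := hT (g i).2
    have h' := h
    rw [hN, Finset.mem_filter] at h'
    exact ⟨h'.1, h, h'.2.2⟩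
  have hqI : q ∈ insert q N := Finset.mem_insert_self q N
  have hI : ∀ i, (g i : EuclideanSpace ℝ (Fin 3)) ∈ insert q N :=
    fun i => Finset.mem_insert_of_mem (hmem i).2.1
  refine seven_thin_unit_vectors_false' e he (fun i => (g i : EuclideanSpace ℝ (Fin 3)) - q)
    (fun i => ?_) (fun i => hle _ (hI i) q hqI) (fun i j hij => ?_) (fun i j => ?_)
  · rw [← dist_eq_norm, dist_comm]; exact (hmem i).2.2
  · have hne : (g i : EuclideanSpace ℝ (Fin 3)) ≠ g j := fun h =>
      hij (g.injective (Subtype.ext h))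
    have e1 : (g i : EuclideanSpace ℝ (Fin 3)) - q - ((g j : EuclideanSpace ℝ (Fin 3)) - q) =
        (g i : EuclideanSpace ℝ (Fin 3)) - g j := by abel
    rw [e1, ← dist_eq_norm]
    exact hQ.1.1 _ (hmem i).1 _ (hmem j).1 hne
  · have e1 : (g i : EuclideanSpace ℝ (Fin 3)) - q - ((g j : EuclideanSpace ℝ (Fin 3)) - q) =
        (g i : EuclideanSpace ℝ (Fin 3)) - g j := by abel
    rw [e1]
    exact hle _ (hI i) _ (hI j)

end Summit.Ventures.Crystal3D.Theorems

end
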